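import Summits.ValiantsHypothesis.ValiantsHypothesis.Theorems.GrenetZeonDualUnipotentThreeHalvesLongMassMixedWords

/-!
# `GrenetZeon.DualUnipotentThreeHalves` (stmt-ValiantsHypothesis-24318), line `slow_core`, stub (c) `SlowCore.LongMassSlowLawInv`:
# THE PURELY ALGEBRAIC FORM of the registered research statement

Composition of ✓ `longMassSlowLawInv_iff_submodule` (`…LongMassSubmodule`: (c) is a statement about nilpotent submodules of `M_b(ℂ)` with
the WINDOW property) and ✓ `window_iff_mixedWords` (`…LongMassMixedWords`: the window property IS the vanishing of all mixed words with more
than `k` letters `w`).  No polynomial ring, no pencil, no coordinates remain: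

★★★ `longMassSlowLawInv_iff_mixedWords` —
`SlowCore.LongMassSlowLawInv ↔ ∃ c n₀, ∀ n ≥ n₀, ∀ b, ∀ V ≤ M_b(ℂ)` (Submodule) with `dim V ≤ n²` and `A^b = 0` on `V`,
`∃ W ≤ V, ∃ k, [∀ A ∈ V, ∀ w ∈ W, ∀ p ≤ n − 1, ∀ q > k: Σ_{ε : Fin p → Bool, |ε| = q} Π_i (if ε i then w else A) = 0] ∧ n·k + (dim V − dim W) ≤ c·√n·b`.

This is the form in which the enemy hunt / RelMMS programme (crit-7 V34 §5–§6) can be run as pure non-commutative algebra: a violator family is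
a sequence of nilpotent matrix spaces `V_n ≤ M_{b_n}(ℂ)` in the live box such that EVERY sub-space `W` of codimension `≤ c√n·b_n − n·k` carries
a pair `(A, w) ∈ V × W` and a word-count `q > k` of some length `p ≤ n − 1` with non-vanishing word sum.
Honest framing.  A REFORMULATION (`--supports stmt-ValiantsHypothesis-24318`), NOT progress on (c): (c) `SlowCore.LongMassSlowLawInv`, S3, the crux
24318, 8062 and `VP ≠ VNP` remain OPEN / NOT proved.  No sorry, no definitions, no named facts.
-/

-- single-conjunct layout: Sub = Summit, duplicated namespace component intended (the name is mandated)
set_option linter.dupNamespace false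
set_option autoImplicit false

noncomputable section

namespace Summit.ValiantsHypothesis.ValiantsHypothesis.Theorems.GrenetZeon.LongMassHomogenise

open MvPolynomial Matrix
open scoped BigOperators
open Summit.ValiantsHypothesis.ValiantsHypothesis.Theorems.GrenetZeon.SlowCore (LongMassSlowLawInv)

/-- ★★★ **(c) AS PURE NON-COMMUTATIVE ALGEBRA**: the registered stub `SlowCore.LongMassSlowLawInv` holds iff every nilpotent matrix
subspace `V ≤ M_b(ℂ)` with `dim V ≤ n²` (`n ≥ n₀`) has a sub-space `W` and an order `k`, of price `n·k + (dim V − dim W) ≤ c·√n·b`, such that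
every `(A, w)`-word sum (`A ∈ V`, `w ∈ W`) of length `≤ n − 1` with more than `k` letters `w` vanishes. -/
theorem longMassSlowLawInv_iff_mixedWords :
    LongMassSlowLawInv ↔
      ∃ c n₀ : ℕ, ∀ n ≥ n₀, ∀ b : ℕ, ∀ V : Submodule ℂ (Matrix (Fin b) (Fin b) ℂ),
        Module.finrank ℂ V ≤ n * n → (∀ A ∈ V, A ^ b = 0) →
        ∃ (W : Submodule ℂ (Matrix (Fin b) (Fin b) ℂ)) (k : ℕ), W ≤ V ∧
          (∀ A ∈ V, ∀ w ∈ W, ∀ p : ℕ, p ≤ n - 1 → ∀ q : ℕ, k < q →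
            (∑ ε ∈ (Finset.univ : Finset (Fin p → Bool)).filter (fun ε => (∑ i, if ε i then 1 else 0) = q),
              (List.ofFn fun i => if ε i then w else A).prod) = 0) ∧
          n * k + (Module.finrank ℂ V - Module.finrank ℂ W) ≤ c * (Nat.sqrt n * b) := by
  rw [longMassSlowLawInv_iff_submodule]
  refine exists_congr fun c => exists_congr fun n₀ => forall_congr' fun n => forall_congr' fun _ => forall_congr' fun b =>
    forall_congr' fun V => forall_congr' fun _ => forall_congr' fun _ => exists_congr fun W => exists_congr fun k => ?_
  rw [window_iff_mixedWords V W n k]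

end Summit.ValiantsHypothesis.ValiantsHypothesis.Theorems.GrenetZeon.LongMassHomogenise

end
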